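import Summits.ResolutionOfSingularities.ResolutionOfSingularities.Theorems.HilbertSamuelEliminationSigmaMaxModificationsCorridor3WLadderStrataLabels
import Summits.ResolutionOfSingularities.ResolutionOfSingularities.Theorems.HilbertSamuelEliminationSigmaMaxModificationsCorridor3MovingCompactnessComposition
import HarnessLib

/-!
# [OURS · L1 W4.2] The STRATA-half of the MOVING W-ladder, second layer (part 2/2): ROW (c) `StrataLineagesFinite`
# REDUCED to the dimension-two kernel (c-geo) and the replay row (c-rep) — PROVED

Crux chain w42 (`SigmaMaxModifications`, stmt-ResolutionOfSingularities-18506; skeleton `w_ladder` v5 on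
`SigmaMaxModificationsCorridor3`, stmt-ResolutionOfSingularities-19249), row «stub-4 successor → `Moving.Wlow3CharStrataM p`»,
seat res-L1-w42-stub-4 (gen 3). Uses part 1/2 (`…Corridor3WLadderStrataLabels`: `treatedLabel`, `pendingLength`, `LabelInv`,
the step anatomy, rows (c-geo) `StrataLineageInCentreIO` / (c-rep) `StrataReplayBlowupsSettle`) and p500484
(`…Corridor3WLadderStrataLineages`: `StepProjection`, `componentsThrough`, Kőnig `exists_section_of_finite_nonempty`, rows (b)/(c)).
OURS (cell res-hironaka, slot W4.2); NOT statements of H. Hironaka's manuscript [Hironaka2017] nor of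
[CossartJannsenSaito2020]; AI-drafted, weaker than expert review. Pure proofs; `--supports stmt-ResolutionOfSingularities-19249`.

## The argument (no geometry; `ν ≠ Φ^{(N)}` NOT needed)

Let `Z_n ∋ x_n` be an infinite dominating lineage of components of the `ν`-strata along a moving chain (row (c)'s
hypothesis). (1) `LabelInv` holds along the chain; (2) the label of the lineage is CONSTANT `= ℓ` («dominates ⇒ inherits»);
(3) the treated label is non-decreasing and `≤ ℓ`, hence EVENTUALLY CONSTANT `= j`; (4) every cycle is finite (`pendingLength`),
so CYCLE ENDS — steps into a state `P = none`, whose centre is the whole treated part `Y_n^{(j)}` — recur for ever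
(`exists_next_none`); (5) by (c-rep) the blow-ups of the chain point are eventually cycle ends, so (the chain being MOVING)
`x_n ∈ Y_n^{(j)}` infinitely often, hence (label-`j` components are never newborn after the year `j`: they have parents through the
previous chain point) at EVERY late stage; (6) KŐNIG on the label-`j` components through the chain points yields a dominating
lineage of label `j`, inside the centre at every cycle end — which (c-geo) forbids.

Proved: `exists_next_none`, `strataLineagesFinite_of_centreIO_of_replaySettle :
StrataLineageInCentreIO p N Q G → StrataReplayBlowupsSettle p N Q G → StrataLineagesFinite p N Q G`, and BY NAME
`wlow3CharStrataM_of_births_centreIO_replaySettle : (b) → (c-geo) → (c-rep) → Wlow3CharStrataM p`,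
`wlowStrataM_of_births_centreIO_replaySettle`. References: CJS LNM 2270 Rem. 6.29 (1), p. 105, p. 107, Thm. 6.35, Prop. 6.31
[CossartJannsenSaito2020]; D. Kőnig 1927 (Mathlib `CategoryTheory.CofilteredSystem`).
-/


noncomputable section

-- plan-1/idea-2 module setting kept (namespace `…Corridor3.Moving` re-enters `…Corridor3`)
set_option linter.dupNamespace false

open CategoryTheory AlgebraicGeometry TopologicalSpace Topology
open Summit.ResolutionOfSingularities.ResolutionOfSingularities.Theorems.CampaignW42
open Literature.AlgebraicGeometry.Resolution Literature.RingTheory.HilbertSamuel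
open Literature.AlgebraicGeometry.CossartJannsenSaito2020
open Summit.ResolutionOfSingularities.ResolutionOfSingularities.Theorems.SigmaMaxModificationsCorridor3

universe u

namespace Summit.ResolutionOfSingularities.ResolutionOfSingularities.Theorems.SigmaMaxModificationsCorridor3.Moving

variable {R : ∀ S : Scheme.{u}, CentreSeq S → Prop} {N : ℕ} {ν : ℕ → ℕ}

/-! ## §4. Along an infinite chain: cycle ends recur, the treated label stabilises -/

/-- **Every cycle ends: along an infinite chain of canonical near steps the state `P = none` recurs** (the pending length
drops to `0` within a cycle). [cite: CossartJannsenSaito2020, Rem. 6.29 (1)] -/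
theorem exists_next_none {c : ℕ → MarkedStage.{u}} (hstep : ∀ n, CanonicalNearStep R N ν (c n) (c (n + 1))) (n : ℕ) :
    ∃ m, n ≤ m ∧ (c (m + 1)).P = none := by
  -- within `pendingLength (c (n+1))` further steps the state `none` is reached
  have key : ∀ k m, pendingLength (c m) = k → ∃ m', m ≤ m' ∧ (c m').P = none := by
    intro k
    induction k with
    | zero => exact fun m hm => ⟨m, le_rfl, pendingLength_eq_zero_iff.mp hm⟩
    | succ k ih =>
      intro m hm
      obtain ⟨m', hmm', hP⟩ := ih (m + 1) ((hstep m).pendingLength_eq_of_succ hm)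
      exact ⟨m', (Nat.le_succ m).trans hmm', hP⟩
  obtain ⟨m', hm', hP⟩ := key _ (n + 1) rfl
  obtain ⟨m, rfl⟩ : ∃ m, m' = m + 1 := ⟨m' - 1, by omega⟩
  exact ⟨m, by omega, hP⟩

/-! ## §5. Row (c) from (c-geo) and (c-rep) -/

/-- **ROW (c) FROM (c-geo) AND (c-rep) — PROVED** (the label bookkeeping of the module docstring, steps (1)–(6)).
[cite: CossartJannsenSaito2020, Rem. 6.29 (1), p. 105, p. 107] -/
theorem strataLineagesFinite_of_centreIO_of_replaySettle {p N : ℕ} {Q : ℕ → (ℕ → ℕ) → ∀ X : Scheme.{u}, X → Prop}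
    {G : MarkedStage.{u} → Prop} (hgeo : StrataLineageInCentreIO p N Q G) (hrep : StrataReplayBlowupsSettle p N Q G) :
    StrataLineagesFinite p N Q G := by
  intro R hRf hRa ν X _ x hX hQ c h0 hstep hG hnI hmov
  rintro ⟨Z, hZ, hdom⟩
  -- (1) the label invariant along the chain; marked points in the strata; Noetherian stages
  have hinv : ∀ n, LabelInv N ν (c n) := fun n =>
    (labelInv_init (N := N) (ν := ν) X x).of_reaches (reaches_chain h0 hstep n)
  have hpt : ∀ n, (c n).pt ∈ Scheme.hsStratum (c n).W N ν := fun n =>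
    pt_mem_hsStratum_of_reaches hX.mem_stratum (reaches_chain h0 hstep n)
  have hne : ∀ n, (Scheme.hsStratum (c n).W N ν).Nonempty := fun n => ⟨_, hpt n⟩
  have hyear : ∀ n, (c n).L.year = (c 0).L.year + n := by
    intro n
    induction n with
    | zero => rfl
    | succ n ih => rw [(hstep n).year_eq, ih]; omega
  -- (2) the label of the lineage is constant
  choose f hf hfZ using hdom
  have hlab : ∀ n, (c n).L.label (Z n) = (c 0).L.label (Z 0) := by
    intro n
    induction n with
    | zero => rfl
    | succ n ih =>
      rw [← ih, (hf n).label_eq_of_mem ((hfZ n).symm ▸ (hZ n).1), hfZ n]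
  set ℓ := (c 0).L.label (Z 0) with hℓ
  -- (3) the treated label is monotone and bounded by `ℓ`, hence eventually constant `= j`
  have hmono : Monotone fun n => treatedLabel N ν (c n) :=
    monotone_nat_of_le_succ fun n => treatedLabel_le_of_step (hinv n) (hstep n) (hne (n + 1))
  have hbdd : ∀ n, treatedLabel N ν (c n) ≤ ℓ := fun n => (hlab n) ▸ treatedLabel_le_label (hinv n) (hZ n).1
  obtain ⟨j, n₂, hj⟩ :=
    Summit.ResolutionOfSingularities.ResolutionOfSingularities.Cruxes.SigmaMaxModifications.MovingCompactnessLine.eventually_const_of_monotone_of_bounded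
      hmono hbdd
  -- (4)+(5) from some stage on, blow-ups of the chain point are cycle ends; moving ⇒ `x_n ∈ Y_n^{(j)}` infinitely often
  obtain ⟨n₁, hn₁⟩ := hrep R hRf hRa ν X x hX hQ c h0 hstep hG hnI hmov
  have hjyear : ∀ n, n₂ ≤ n → j ≤ (c n).L.year := fun n hn => (hj n hn) ▸ treatedLabel_le_year (hinv n) (hne n)
  -- label-`j` components through the chain point
  let T : ∀ n, Set (Set (c n).W) := fun n => {W | W ∈ componentsThrough N ν (c n) ∧ (c n).L.label W = j}
  -- parents: past stage `n₃` a label-`j` component through `x_{n+1}` dominates a label-`j` component through `x_n`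
  set n₃ := max n₁ n₂ + 1 with hn₃
  have hparent : ∀ n, n₃ ≤ n → ∀ W' ∈ T (n + 1), closure ((f n).base '' W') ∈ T n := by
    intro n hn W' ⟨hW', hlW'⟩
    have hne' : (c (n + 1)).L.label W' ≠ (c n).L.year + 1 := by
      rw [hlW']
      have := hjyear n (by omega)
      omega
    have hmem := (hf n).mem_componentsIn_of_label_ne hne'
    exact ⟨closure_image_mem_componentsThrough (hf n) hW' hmem, ((hf n).label_eq_of_mem hmem) ▸ hlW'⟩
  -- non-emptiness at every late stage: at a late blown-up stage the step is a cycle end for `j`, so `x_n ∈ Y_n^{(j)}`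
  have hT_of_blownUp : ∀ n, n₃ ≤ n → (c n).IsBlownUp R N ν → (T n).Nonempty := by
    intro n hn hbu
    obtain ⟨C, P', hcs, hptC⟩ := hbu
    have hnone : (c (n + 1)).P = none := hn₁ n (by omega) ⟨C, P', hcs, hptC⟩
    have hsupp := support_eq_part_of_next_none hRf (hstep n) hnone hcs
    rw [hsupp, hj n (by omega)] at hptC
    obtain ⟨W, hW, hlW, hxW⟩ := ((c n).L.mem_part_iff _ j _).mp hptC
    exact ⟨W, ⟨hW, hxW⟩, hlW⟩
  have hdesc : ∀ d n, n₃ ≤ n → (T (n + d)).Nonempty → (T n).Nonempty := by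
    intro d
    induction d with
    | zero => exact fun n _ h => h
    | succ d ih =>
      intro n hn h
      obtain ⟨W', hW'⟩ := h
      exact ih n hn ⟨_, hparent (n + d) (by omega) W' hW'⟩
  have hTne : ∀ n, n₃ ≤ n → (T n).Nonempty := by
    intro n hn
    obtain ⟨m, hnm, hbu⟩ := hmov n
    obtain ⟨d, rfl⟩ := Nat.exists_eq_add_of_le hnm
    exact hdesc d n hn (hT_of_blownUp (n + d) (by omega) hbu)
  -- (6) Kőnig on the label-`j` components through the chain points of the tail from `n₃`
  let c' : ℕ → MarkedStage.{u} := fun n => c (n₃ + n)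
  have hN : ∀ n, IsNoetherian (c' n).W := fun n => isNoetherian_of_reaches_init hX (reaches_chain h0 hstep (n₃ + n))
  let F : ℕ → Type u := fun n => ↥(T (n₃ + n))
  haveI : ∀ n, Finite (F n) := fun n => by
    haveI := hN n
    exact ((componentsThrough_finite (N := N) (ν := ν) (c' n)).subset fun _ h => h.1).to_subtype
  haveI : ∀ n, Nonempty (F n) := fun n => (hTne (n₃ + n) (Nat.le_add_right _ _)).to_subtype
  obtain ⟨u, hu⟩ := exists_section_of_finite_nonempty (F := F) fun n W' =>
    ⟨closure ((f (n₃ + n)).base '' W'.1), hparent (n₃ + n) (Nat.le_add_right _ _) W'.1 W'.2⟩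
  -- the section is a dominating lineage of label `j` through the chain points, in the centre at every cycle end
  refine hgeo R hRf hRa ν X x hX hQ c' (reaches_chain h0 hstep n₃) (fun n => hstep (n₃ + n)) (fun n => hG _)
    (fun n => hnI _) (io_shift hmov n₃) ⟨fun n => (u n).1, fun n => (u n).2.1, fun n =>
      ⟨f (n₃ + n), hf (n₃ + n), congrArg Subtype.val (hu n)⟩, fun n => ?_⟩
  obtain ⟨m, hnm, hnone⟩ := exists_next_none (c := c') (fun n => hstep (n₃ + n)) n
  obtain ⟨C, P', hln, x', hcs, -, -, -, -⟩ := hstep (n₃ + m)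
  refine ⟨m, hnm, C, P', hcs, ?_⟩
  rw [support_eq_part_of_next_none hRf (hstep (n₃ + m)) hnone hcs, hj (n₃ + m) (by omega)]
  exact (c (n₃ + m)).L.subset_part (u m).2.1.1 (u m).2.2

/-- **`Wlow3CharStrataM p` FROM ROWS (b), (c-geo), (c-rep)** (by name, `N = 3`, `Q = QCharRegime p`, `G = (ē ≤ 2)`).
[cite: CossartJannsenSaito2020, Thm. 6.35, Prop. 6.31, Rem. 6.29 (1)] -/
theorem wlow3CharStrataM_of_births_centreIO_replaySettle {p : ℕ}
    (hB : StrataBirthsSettle.{0} p 3 (Helpers.QCharRegime p) fun s => s.geomDirDim ≤ 2)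
    (hgeo : StrataLineageInCentreIO.{0} p 3 (Helpers.QCharRegime p) fun s => s.geomDirDim ≤ 2)
    (hrep : StrataReplayBlowupsSettle.{0} p 3 (Helpers.QCharRegime p) fun s => s.geomDirDim ≤ 2) :
    Wlow3CharStrataM p :=
  wlow3CharStrataM_of_lineages hB (strataLineagesFinite_of_centreIO_of_replaySettle hgeo hrep)

/-- **`WlowStrataM p` FROM ROWS (b), (c-geo), (c-rep)** (regime-free, `Q = ⊤`). [cite: CossartJannsenSaito2020, Thm. 6.35, Prop. 6.31] -/
theorem wlowStrataM_of_births_centreIO_replaySettle {p : ℕ}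
    (hB : StrataBirthsSettle.{0} p 3 (fun _ _ _ _ => True) fun s => s.geomDirDim ≤ 2)
    (hgeo : StrataLineageInCentreIO.{0} p 3 (fun _ _ _ _ => True) fun s => s.geomDirDim ≤ 2)
    (hrep : StrataReplayBlowupsSettle.{0} p 3 (fun _ _ _ _ => True) fun s => s.geomDirDim ≤ 2) :
    WlowStrataM p :=
  wlowStrataM_of_lineages hB (strataLineagesFinite_of_centreIO_of_replaySettle hgeo hrep)

end Summit.ResolutionOfSingularities.ResolutionOfSingularities.Theorems.SigmaMaxModificationsCorridor3.Moving

end
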